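import Summits.Ventures.YMGap.Thresholds.HessianSharpBound
import Summits.Ventures.YMGap.Thresholds.QuarterModulusOneThird
import Summits.Ventures.YMGap.StrongCouplingGapFromCertificate
import Summits.Ventures.YMGap.TwoDimVortexRatio
import Literature.MathematicalPhysics.QuantumFieldTheory.TomboulisVortexDecimation
import Summits.Ventures.YMGap.Thresholds.QuarterModulusTwoThirds
import Literature.MathematicalPhysics.QuantumFieldTheory.DurhuusFrohlichSlabCriterionProofs
import Summits.Ventures.YMGap.Thresholds.SharpUniqueness
import Summits.Ventures.YMGap.Census.HypercubeExponentThreeCube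
import Summits.Ventures.YMGap.Census.VortexRatioTwoCube
import Summits.Ventures.YMGap.Census.VortexRatioThreeCube
import Summits.Ventures.YMGap.Thresholds.StarWindowBoundLemmaG
import Summits.Ventures.YMGap.Thresholds.StarLemmaGRows
import Summits.Ventures.YMGap.Thresholds.StarInfiniteVolume
import Summits.Ventures.YMGap.Thresholds.ImprovedThresholdStar
import Summits.Ventures.YMGap.Thresholds.StarMassGapSUN
import Summits.Ventures.YMGap.Thresholds.StarSUNRows
import Summits.Ventures.YMGap.Thresholds.StarFrontSUN
import Summits.Ventures.YMGap.Thresholds.StarMassiveSUNRows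
import Summits.Ventures.YMGap.Thresholds.CouplingSignFlipMassive
import Summits.Ventures.YMGap.StatementConjunctsV13
import Summits.Ventures.YMGap.StatementConjunctsV14
import Summits.Ventures.YMGap.StatementConjunctsV15
import Summits.Ventures.YMGap.StatementConjunctsV16
import HarnessLib

/-!
# Venture statement — YMGap (cell `pub-ymgap`) — DRAFT v0 (2026-08-22, seat p3) + appends v1 … v1.6 (T1–T31)

HONEST FRAMING. WHAT THIS IS: the theorem-level output of the cell as ONE `Prop` — the conjunction of
kernel-checked statements about (a) the STRONG-COUPLING regime of lattice `SU(N)` Yang–Mills (Hessian constant,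
area-law windows, DLR uniqueness / mass-gap windows, massive states) — from v1.5 on also with the Wilson action
replaced by any member of a TYPED BALL of gauge-invariant perturbations (track Y2), and (b) Tomboulis's 2007
vortex inequalities on FINITE tori and in the exactly solvable two-dimensional case. WHAT THIS IS NOT: no
continuum statement, no mass gap at any fixed physical coupling, no clustering rate beyond the displayed ones /
`∃ m > 0`, no claim on the Yang–Mills Millennium problem, no verdict on Tomboulis's disputed (5.15) in `d ≥ 3`.
Every threshold / ball radius below is where a BOUND is certified to close, not a physical transition.
Conditional conjuncts DISPLAY their hypotheses as binders (T2: printed slab criterion, discharged in T5; T6: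
three printed facts; T8: the census engines' table identities; T19/T20: two certified one-link inequalities);
all others carry none; T28 is a refutation (a strengthening of T26's currency is false). It STAYS A DRAFT until
the operator adopts it; it is APPEND-ONLY (earlier declarations byte-identical, meanings unchanged); from v1.3 on
the conjunct BODIES (with plain-language docstrings) live in per-version files `StatementConjunctsV1k.lean` and
this file appends only the index `YMGapStatementV1_k := YMGapStatementV1_{k-1} ∧ …` (400-line cap). Conjunct
index: v0 T1–T4 · v1 T5–T8 (PLAN R104) · v1.1 T9–T10 (R120) · v1.2 T11–T15 (R135) — bodies below; v1.3 T17, T19,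
T20 (`StatementConjunctsV13`) · v1.4 T16, T18, T21 (`StatementConjunctsV14`) · v1.5 T22–T28 (`StatementConjunctsV15`:
track Y2 ROBUST-BALL, R200) · v1.6 T30, T31 (`StatementConjunctsV16`, R201: Tomboulis's decimation propositions; area law on
the ball, all `N`; T29 reserved). Plain-language table of every conjunct: `lean/STATEMENT-V1-SUMMARY.md`.
-/

noncomputable section

namespace Summit.Ventures.YMGap

open Matrix
open Literature.MathematicalPhysics.QuantumFieldTheory
open Literature.MathematicalPhysics.QuantumLattice (fundamentalRep)

/-- **T1 — THEOREM C: the Hessian form of the Wilson action is bounded by `4d`** (all `N, d, L`). -/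
def T1_HessianSharp : Prop :=
  ∀ (N d L : ℕ) [NeZero L] (Q X : Edge d L → Matrix (Fin N) (Fin N) ℂ),
    (∀ e, (Q e)ᴴ * Q e = 1) → (∀ e, (X e)ᴴ = -X e) →
      HessianSharp.hessianTotal Q X ≤ 4 * (d : ℝ) * HessianSharp.fieldNormSq X

/-- T1 holds (`HessianSharp.hessianTotal_le_four_d'`). -/
theorem T1_HessianSharp_holds : T1_HessianSharp :=
  fun _ _ _ _ Q X hQ hX => HessianSharp.hessianTotal_le_four_d' Q X hQ hX

/-- **T2 — `SU(2)`, `d = 4`: Wilson area law for every `0 ≤ β_W ≤ 1/3`, CONDITIONAL on the printed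
Durhuus–Fröhlich slab criterion** (named fact `durhuusFrohlich_areaLaw_of_slabClustering 4 2`). -/
def T2_SU2AreaLawOneThird : Prop :=
  durhuusFrohlich_areaLaw_of_slabClustering 4 2 →
    ∀ βW : ℝ, 0 ≤ βW → βW ≤ 1 / 3 → HasAreaLaw 4 (fundamentalRep (Fin 2)) (βW / 2)

/-- T2 holds (`QuarterModulusOneThird.su2_hasAreaLaw_le_oneThird`). -/
theorem T2_SU2AreaLawOneThird_holds : T2_SU2AreaLawOneThird :=
  fun h _ hβ hle => QuarterModulusOneThird.su2_hasAreaLaw_le_oneThird h hβ hle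

/-- **T3 — `SU(2)`, `d = 4`: the mass-gap bar of record** (`MassGapAt` for all `0 ≤ β < 1/18`,
't Hooft units; `β_W < 2/9`). -/
def T3_SU2MassGapBar : Prop := MassGapOnWindow 4 2 0 (1 / 18)

/-- T3 holds (`su2_massGapOnWindow_twoNinths`). -/
theorem T3_SU2MassGapBar_holds : T3_SU2MassGapBar := su2_massGapOnWindow_twoNinths

/-- **T4 — the two-dimensional shadow of Tomboulis's monotonicity (5.24) holds**: `R_A(α)` is
strictly decreasing on `[0, ∞)`. -/
def T4_TwoDimShadow : Prop :=
  ∀ (A J : ℕ), 1 ≤ A → 1 ≤ J → ∀ c : ℕ → ℝ, (∀ n, 0 ≤ c n) → 0 < c 1 →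
    StrictAntiOn (twoDimRatio A J c) (Set.Ici 0)

/-- T4 holds (`twoDimRatio_strictAntiOn`). -/
theorem T4_TwoDimShadow_holds : T4_TwoDimShadow :=
  fun _ _ hA hJ _ hc h1 => twoDimRatio_strictAntiOn hA hJ hc h1

/-- **The venture statement (DRAFT v0)**: `T1 ∧ T2 ∧ T3 ∧ T4`. -/
def YMGapStatement : Prop :=
  T1_HessianSharp ∧ T2_SU2AreaLawOneThird ∧ T3_SU2MassGapBar ∧ T4_TwoDimShadow

/-- The draft statement is PROVED. -/
theorem yMGapStatement_holds : YMGapStatement :=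
  ⟨T1_HessianSharp_holds, T2_SU2AreaLawOneThird_holds, T3_SU2MassGapBar_holds, T4_TwoDimShadow_holds⟩

/-! ## DRAFT v1 append (2026-08-22 afternoon, seat p3-g2): conjuncts landed since v0
HONEST FRAMING (v1): T5–T8 are, like T1–T4, kernel-checked statements about the STRONG-COUPLING lattice regime or
about FINITE tori; T6 is CONDITIONAL on three named printed facts (Bakry–Émery kernel log-Sobolev, Stroock–Zegarlinski
uniqueness, Shen–Zhu–Zhu's transfer), T8 on the displayed table identities of the census engines (class C); T5 and T7
carry NO hypothesis; nothing here is a continuum or Millennium statement. `YMGapStatement` (v0) keeps its meaning;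
`YMGapStatementV1 := YMGapStatement ∧ T5 ∧ T6 ∧ T7 ∧ T8`. -/

/-- **T5 — `SU(2)`, `d = 4`: Wilson area law for every `0 ≤ β_W < 2/3`, UNCONDITIONAL** (four
times the printed `1/6`; the quarter-modulus slab door at its own ceiling, `QuarterModulusTwoThirds`,
composed with the tree's DISCHARGE of the printed Durhuus–Fröhlich slab criterion,
`durhuusFrohlich_areaLaw_of_slabClustering_holds`). Supersedes the conditional T2 in content (T2 is
kept verbatim, append-only). A strong-coupling lattice statement; `2/3` is where the slab constant
`6 β_W/4 < 1` closes. -/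
def T5_SU2AreaLawTwoThirds : Prop :=
  ∀ βW : ℝ, 0 ≤ βW → βW < 2 / 3 → HasAreaLaw 4 (fundamentalRep (Fin 2)) (βW / 2)

/-- T5 holds (`QuarterModulusTwoThirds.su2_hasAreaLaw_lt_twoThirds` +
`durhuusFrohlich_areaLaw_of_slabClustering_holds`). -/
theorem T5_SU2AreaLawTwoThirds_holds : T5_SU2AreaLawTwoThirds :=
  fun _ hβ hlt => QuarterModulusTwoThirds.su2_hasAreaLaw_lt_twoThirds
    durhuusFrohlich_areaLaw_of_slabClustering_holds hβ hlt

/-- **T6 — track (a) target type: mass gap (DLR uniqueness + exponential clustering) for `SU(N)`,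
all `N ≥ 2`, `d ≥ 3`, at every `|β| < 1/(8d)`** (`ImprovedThreshold d N (HessianSharp.sharpThresholdSU d)`;
`d = 4`: `1/32` against the printed `1/48`), CONDITIONAL on the three named printed facts
`bakryEmery_kernelLogSobolev`, `stroockZegarlinski_uniqueness`, `shenZhuZhu_massGap_transfer`. -/
def T6_SharpThreshold : Prop :=
  ∀ (d N : ℕ), bakryEmery_kernelLogSobolev d N → stroockZegarlinski_uniqueness d N →
    shenZhuZhu_massGap_transfer d N → 3 ≤ d → 2 ≤ N → ImprovedThreshold d N (HessianSharp.sharpThresholdSU d)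

/-- T6 holds (`improvedThreshold_sharp`). -/
theorem T6_SharpThreshold_holds : T6_SharpThreshold :=
  fun _ _ h₁ h₂ h₃ hd hN => HessianSharp.improvedThreshold_sharp h₁ h₂ h₃ hd hN

/-- **T7 — track (c): the STAR DOOR for `SU(2)`, `d = 4`, UNCONDITIONAL** (Dobrushin–Shlosman
window condition with vertex-star windows; gauge-fixed received sum `R_G(β_W) = 6c(1+c)/(1−4c−6c²)`,
`c = β_W/4`; `R_G < 1` iff `β_W < (√37−5)/3 ≈ 0.3609`): (i) the WINDOW form — the star window bound
`StarWindowBound L β_W (R_G β_W) (Frobenius weight)` on every torus `(ℤ/L)^4`, `L ≥ 3`, for every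
`0 ≤ β_W ≤ 1/2` (`StarLemmaG.starWindowBound_lemmaG`); (ii) the CLUSTERING ROW — for every
`0 ≤ β_W ≤ 9/25`, every `L ≥ 3` and every pair of admissible link observables whose endpoints are
`≥ L₀` apart, `|cov(f,g)| ≤ 4(2√2)² exp(−(1−R_G)²L₀/(2(16R_G+1))) (Σδf)(Σδg)` under the torus Wilson
measure at tree coupling `β_W/2` (`StarLemmaG.su2Star_abs_covariance_le_of_le_9_25`); (iii) the
strong-coupling FRONT of the crossover ledger at tree coupling `9/50` (Wilson `β_W = 9/25`)
(`StarLemmaG.su2_strongCouplingFront_9_50`). Strong-coupling LATTICE statements; `9/25` is where the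
bound `R_G < 1` is certified, not a physical transition; nothing about the continuum or a mass gap in
physical units. -/
def T7_SU2StarDoor : Prop :=
  (∀ (L : ℕ) [NeZero L], 3 ≤ L → ∀ βW : ℝ, 0 ≤ βW → βW ≤ 1 / 2 →
      DSWindow.StarWindowBound L βW (StarWindowGauge.gaugeR βW) suFrobDist) ∧
    (∀ (L : ℕ) [NeZero L], 3 ≤ L → ∀ βW : ℝ, 0 ≤ βW → βW ≤ 9 / 25 →
      ∀ (f g : GaugeConfig 4 L (Matrix.specialUnitaryGroup (Fin 2) ℂ) → ℝ) (Δf Δg : Finset (Edge 4 L))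
        (δf δg : Edge 4 L → ℝ), DSWindow.LinkObs suFrobDist f Δf δf → DSWindow.LinkObs suFrobDist g Δg δg →
        ∀ L₀ : ℕ, (∀ x ∈ Δf, ∀ z ∈ Δg, ∀ a ∈ DSWindow.linkEnds x, ∀ w ∈ DSWindow.linkEnds z,
          L₀ ≤ torusNorm (a - w)) →
        |ProbabilityTheory.covariance f g
            (wilsonMeasure (d := 4) (L := L) (fundamentalRep (Fin 2)) (βW / 2))| ≤
          4 * (2 * Real.sqrt 2) ^ 2 *
            Real.exp (-((1 - StarWindowGauge.gaugeR βW) ^ 2 /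
              (2 * (16 * StarWindowGauge.gaugeR βW + 1)) * L₀)) *
            (∑ x ∈ Δf, δf x) * ∑ y ∈ Δg, δg y) ∧
    Balaban1983to89.CrossoverLedger.StrongCouplingFront
      (Literature.MathematicalPhysics.QuantumLattice.fundamentalLatticeRep 2) (9 / 50)

/-- T7 holds (`StarLemmaG.starWindowBound_lemmaG`, `StarLemmaG.su2Star_abs_covariance_le_of_le_9_25`,
`StarLemmaG.su2_strongCouplingFront_9_50`). -/
theorem T7_SU2StarDoor_holds : T7_SU2StarDoor :=
  ⟨fun _ _ hL _ h0 h12 => StarLemmaG.starWindowBound_lemmaG hL h0 h12,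
    fun _ _ hL _ h0 h _ _ _ _ _ _ hf hg L₀ hL₀ =>
      StarLemmaG.su2Star_abs_covariance_le_of_le_9_25 hL h0 h hf hg L₀ hL₀,
    StarLemmaG.su2_strongCouplingFront_9_50⟩

/-- **T8 — census kernel rows on finite tori (K-conditional on the engines' table identities, class C)**:
(i) on `(ℤ/3)³`, one-character ray, Tomboulis's (2.13) with the PRINTED exponent `#plaquettes = 81`
FAILS (`¬ HypercubeLowerBoundExp 3 3 1 81`); (ii) on `(ℤ/2)³` Tomboulis's (5.24) HOLDS for every
one-character vector with `0 ≤ c_{1/2} ≤ 3/4`; (iii) on `(ℤ/3)³` it HOLDS for every one-character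
vector with `0 ≤ c_{1/2}` (`VortexRatioAntitone 3 L 1 c 𝒱₀₁`). Finite-torus statements only. -/
def T8_CensusRows : Prop :=
  (Census.TableIdentity333 → ¬ Tomboulis2007.HypercubeLowerBoundExp 3 3 1 81) ∧
    (Census.TableIdentity222 → Census.TableIdentity222tw → ∀ c : ℕ → ℝ, 0 ≤ c 1 → c 1 ≤ 3 / 4 →
      Tomboulis2007.VortexRatioAntitone 3 2 1 c Census.sheet01) ∧
    (Census.TableIdentity333 → Census.TableIdentity333tw → ∀ c : ℕ → ℝ, 0 ≤ c 1 →
      Tomboulis2007.VortexRatioAntitone 3 3 1 c Census.sheet01three)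

/-- T8 holds (`Census.not_hypercubeLowerBoundExp_333`, `Census.vortexRatioAntitone_222`,
`Census.vortexRatioAntitone_333`). -/
theorem T8_CensusRows_holds : T8_CensusRows :=
  ⟨Census.not_hypercubeLowerBoundExp_333, Census.vortexRatioAntitone_222,
    Census.vortexRatioAntitone_333⟩

/-- **The venture statement, DRAFT v1**: `YMGapStatement ∧ T5 ∧ T6 ∧ T7 ∧ T8`. -/
def YMGapStatementV1 : Prop :=
  YMGapStatement ∧ T5_SU2AreaLawTwoThirds ∧ T6_SharpThreshold ∧ T7_SU2StarDoor ∧ T8_CensusRows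

/-- The v1 draft statement is PROVED (T6 carries its printed hypotheses INSIDE the statement, T8 its
table identities; T5 and T7 are unconditional). -/
theorem yMGapStatementV1_holds : YMGapStatementV1 :=
  ⟨yMGapStatement_holds, T5_SU2AreaLawTwoThirds_holds, T6_SharpThreshold_holds, T7_SU2StarDoor_holds,
    T8_CensusRows_holds⟩

/-! ## DRAFT v1.1 append (2026-08-22, seat p3-g2, PLAN R120): the infinite-volume rows
HONEST FRAMING (v1.1): T9 and T10 are kernel-checked and carry NO hypothesis; STRONG-COUPLING lattice `SU(2)`
Yang–Mills on `ℤ⁴` (DLR states of the Wilson specification; `MassGapAt` = unique DLR state + exponential clustering of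
Lipschitz cylinder observables, rate `∃ c > 0`). `9/100` ('t Hooft units) = Wilson `9/25` is where the star door's received
sum `R_G < 1` is certified — a bound closing, not a physical transition. No continuum statement, no spectral/transfer-matrix
gap, no `SU(N ≥ 3)`, no Millennium claim. -/

/-- **T9 — `SU(2)`, `d = 4`, INFINITE VOLUME, UNCONDITIONAL**: (i) the mass gap `MassGapAt 4 2 β`
(the currency of T3 and of track (a)'s `ImprovedThreshold`) at every 't Hooft coupling
`0 ≤ β ≤ 9/100` — T3's hypothesis-free bar `β < 1/18` raised to `β ≤ 9/100`
(`DSWindowZd.su2_massGapAt_le_9_100`); (ii) exactly ONE DLR state of the Wilson specification at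
every `0 ≤ β_W ≤ 9/25` (`DSWindowZd.su2_hasUniqueGibbsMeasure_le_9_25`); (iii) the thermodynamic
limit of the torus states exists and is unique at every `0 ≤ β_W ≤ 9/25`
(`DSWindowZd.su2_hasUniqueInfiniteVolumeLimit_le_9_25`). Chain: Lemma G (T7) → torus/`ℤ⁴` transfer
→ Dobrushin–Shlosman uniqueness door → limit-state clustering. -/
def T9_SU2MassGapNineHundredths : Prop :=
  (∀ β : ℝ, 0 ≤ β → β ≤ 9 / 100 → MassGapAt 4 2 β) ∧
    (∀ βW : ℝ, 0 ≤ βW → βW ≤ 9 / 25 →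
      Literature.Probability.LatticeModels.HasUniqueGibbsMeasure
        (Literature.MathematicalPhysics.QuantumLattice.ymSpecification (d := 4) (fundamentalRep (Fin 2))
          ((2 : ℕ) * (βW / 4)))) ∧
    (∀ βW : ℝ, 0 ≤ βW → βW ≤ 9 / 25 →
      Literature.MathematicalPhysics.QuantumLattice.HasUniqueInfiniteVolumeLimit (d := 4)
        (fundamentalRep (Fin 2)) (βW / 2))

/-- T9 holds (`DSWindowZd.su2_massGapAt_le_9_100`, `DSWindowZd.su2_hasUniqueGibbsMeasure_le_9_25`,
`DSWindowZd.su2_hasUniqueInfiniteVolumeLimit_le_9_25`). -/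
theorem T9_SU2MassGapNineHundredths_holds : T9_SU2MassGapNineHundredths :=
  ⟨fun _ h0 h => DSWindowZd.su2_massGapAt_le_9_100 h0 h,
    fun _ h0 h => DSWindowZd.su2_hasUniqueGibbsMeasure_le_9_25 h0 h,
    fun _ h0 h => DSWindowZd.su2_hasUniqueInfiniteVolumeLimit_le_9_25 h0 h⟩

/-- **T10 — the track-(a) TARGET TYPE met for `SU(2)`, `d = 4`, UNCONDITIONALLY**:
`ImprovedThreshold 4 2 (9/100)`, i.e. `1/(16·3) < 9/100` AND `MassGapBelow 4 2 (9/100)` (mass gap at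
every 't Hooft `|β| < 9/100`, two-sided via the centre sign flip) — `4.32 ×` Shen–Zhu–Zhu's printed
`1/48`, in their currency (`ImprovedThresholdStar.su2_improvedThreshold_9_100`). Compare T6: all
`N ≥ 2`, `d ≥ 3` at `1/(8d)` but CONDITIONAL on three printed facts. -/
def T10_SU2ImprovedThreshold : Prop := ImprovedThreshold 4 2 (9 / 100)

/-- T10 holds (`ImprovedThresholdStar.su2_improvedThreshold_9_100`). -/
theorem T10_SU2ImprovedThreshold_holds : T10_SU2ImprovedThreshold :=
  ImprovedThresholdStar.su2_improvedThreshold_9_100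

/-- **The venture statement, DRAFT v1.1**: `YMGapStatementV1 ∧ T9 ∧ T10`. -/
def YMGapStatementV1_1 : Prop :=
  YMGapStatementV1 ∧ T9_SU2MassGapNineHundredths ∧ T10_SU2ImprovedThreshold

/-- The v1.1 draft statement is PROVED (T9, T10 unconditional; T6 keeps its three printed facts and T8
its table identities inside `YMGapStatementV1`). -/
theorem yMGapStatementV1_1_holds : YMGapStatementV1_1 :=
  ⟨yMGapStatementV1_holds, T9_SU2MassGapNineHundredths_holds, T10_SU2ImprovedThreshold_holds⟩

/-! ## DRAFT v1.2 append (2026-08-22 evening, seat p3-g3, PLAN R135 = R120″): the rows for every `N ≥ 2`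
HONEST FRAMING (v1.2): T11–T15 are kernel-checked and carry NO hypothesis; each `_holds` closes by one tree
constant per clause. STRONG-COUPLING lattice `SU(N)` Yang–Mills on `ℤ⁴` (`d = 4` only): DLR states of the Wilson
specification at tree coupling `β` with `|β|/N ≤ 9/308` ('t Hooft scaling; T15: `SU(2)`, Wilson `β_W`, tree coupling
`β_W/2`). `9/308 = 0.0292…` is where the generic-`N` star door's received sum closes (Bakry–Émery one-link modulus
`K = 1/(1/2 − 6|β|/N)`) — a bound closing, not a physical transition; Shen–Zhu–Zhu print `1/48` in the same scaling.
"Massive" (`IsMassiveState`) = the tree's Osterwalder–Seiler clustering clause with rate `∃ m > 0`; `MassGapAt` =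
unique DLR state + exponential clustering of Lipschitz cylinder observables. No continuum statement, no
spectral/transfer-matrix gap, no Millennium claim. Texts: T11–T13 seat ds-1 (g4), T14–T15 ds-3 (g6);
`YMGapStatementV1_1` keeps its meaning; `YMGapStatementV1_2 := YMGapStatementV1_1 ∧ T11 ∧ T12 ∧ T13 ∧ T14 ∧ T15`. -/

open Literature.Probability.LatticeModels (HasUniqueGibbsMeasure HasExponentialDecay)
open Literature.MathematicalPhysics.QuantumLattice (fundamentalLatticeRep ymSpecification ymGibbsMeasures
  plaquetteCorrFn)
open Literature.Barriers.QuantumFields (IsMassiveState)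

/-- **T11 — the track-(a) TARGET TYPE for EVERY `N ≥ 2`, `d = 4`, UNCONDITIONAL**:
`ImprovedThreshold 4 N (9/308)`, i.e. `1/(16·3) < 9/308` AND `MassGapBelow 4 N (9/308)` (mass gap at
every 't Hooft `|β| < 9/308`, two-sided) — Shen–Zhu–Zhu's printed `1/48` times `108/77`, in their
currency (`StarSUNLimit.improvedThreshold_SU_star`). `SU(2)` keeps the stronger T10 (`9/100`); compare
T6: all `N ≥ 2`, `d ≥ 3` at `1/(8d)` but CONDITIONAL on three printed facts. -/
def T11_SUNImprovedThreshold : Prop := ∀ N : ℕ, 2 ≤ N → ImprovedThreshold 4 N (9 / 308)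

/-- T11 holds (`StarSUNLimit.improvedThreshold_SU_star`). -/
theorem T11_SUNImprovedThreshold_holds : T11_SUNImprovedThreshold :=
  fun _ hN => StarSUNLimit.improvedThreshold_SU_star hN

/-- **T12 — DLR UNIQUENESS for EVERY `N ≥ 2`, `d = 4`, two-sided, UNCONDITIONAL**: exactly one DLR
state of the Wilson specification of `SU(N)` lattice Yang–Mills on `ℤ⁴` at every tree coupling `β`
with `|β|/N ≤ 9/308` (`StarSUN.hasUniqueGibbsMeasure_abs`). -/
def T12_SUNUniqueness : Prop :=
  ∀ N : ℕ, 2 ≤ N → ∀ β : ℝ, |β| / N ≤ 9 / 308 →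
    HasUniqueGibbsMeasure (ymSpecification (d := 4) (fundamentalRep (Fin N)) β)

/-- T12 holds (`StarSUN.hasUniqueGibbsMeasure_abs`). -/
theorem T12_SUNUniqueness_holds : T12_SUNUniqueness :=
  fun _ hN _ h => StarSUN.hasUniqueGibbsMeasure_abs hN h

/-- **T13 — the strong-coupling FRONT of the crossover ledger for EVERY `N ≥ 2`, `d = 4`,
UNCONDITIONAL**: `StrongCouplingFront (fundamentalLatticeRep N) β₀` at every tree coupling
`0 ≤ β₀` with `β₀/N ≤ 9/308` (`StarSUNFront.strongCouplingFront_SU_star`; at `N = 2` this gives only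
`β₀ ≤ 9/154` — T7 (iii), the `SU(2)`-specific row at `β₀ = 9/50`, is stronger). -/
def T13_SUNFront : Prop :=
  ∀ N : ℕ, 2 ≤ N → ∀ β₀ : ℝ, 0 ≤ β₀ → β₀ / N ≤ 9 / 308 →
    Balaban1983to89.CrossoverLedger.StrongCouplingFront (fundamentalLatticeRep N) β₀

/-- T13 holds (`StarSUNFront.strongCouplingFront_SU_star`). -/
theorem T13_SUNFront_holds : T13_SUNFront :=
  fun _ hN _ h0 h => StarSUNFront.strongCouplingFront_SU_star hN h0 h

/-- **T14 — for EVERY `N ≥ 2`, `d = 4`, EVERY DLR STATE IS MASSIVE, two-sided, UNCONDITIONAL**: at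
every tree coupling `β` with `|β|/N ≤ 9/308`, every DLR state `μ` of `SU(N)` lattice Yang–Mills on `ℤ⁴`
is massive (`IsMassiveState μ`: one rate `m > 0` for all truncated correlations of bounded measurable
gauge-invariant local observables) and its plaquette–plaquette correlation function
`plaquetteCorrFn` decays exponentially (`StarSUNMassive.isMassiveState_dlr_SU_star`,
`StarSUNMassive.hasExponentialDecay_plaquetteCorrFn_dlr_SU_star`). By T12 the DLR state is unique,
so "every" and "the" coincide; the clause is stated for every DLR state as proved. -/
def T14_SUNMassive : Prop :=
  ∀ N : ℕ, 2 ≤ N → ∀ β : ℝ, |β| / N ≤ 9 / 308 →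
    ∀ μ ∈ ymGibbsMeasures (d := 4) (fundamentalRep (Fin N)) β,
      IsMassiveState μ ∧ HasExponentialDecay (plaquetteCorrFn (fundamentalRep (Fin N)) μ)

/-- T14 holds (`StarSUNMassive.isMassiveState_dlr_SU_star`,
`StarSUNMassive.hasExponentialDecay_plaquetteCorrFn_dlr_SU_star`). -/
theorem T14_SUNMassive_holds : T14_SUNMassive :=
  fun _ hN _ h μ hμ => ⟨StarSUNMassive.isMassiveState_dlr_SU_star hN h μ hμ,
    StarSUNMassive.hasExponentialDecay_plaquetteCorrFn_dlr_SU_star hN h μ hμ⟩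

/-- **T15 — `SU(2)`, `d = 4`: massive + plaquette–plaquette decay for EVERY DLR STATE at every
Wilson `|β_W| ≤ 9/25`, TWO-SIDED, UNCONDITIONAL** (tree coupling `β_W/2`; the negative side by the
staggered centre sign flip; T9's window `0 ≤ β_W ≤ 9/25` extended to both signs and stated for every
DLR state) (`SignFlip.su2_isMassiveState_dlr_of_abs_le`,
`SignFlip.su2_hasExponentialDecay_plaquetteCorrFn_dlr_of_abs_le`). -/
def T15_SU2MassiveTwoSided : Prop :=
  ∀ βW : ℝ, |βW| ≤ 9 / 25 →
    ∀ μ ∈ ymGibbsMeasures (d := 4) (fundamentalRep (Fin 2)) (βW / 2),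
      IsMassiveState μ ∧ HasExponentialDecay (plaquetteCorrFn (fundamentalRep (Fin 2)) μ)

/-- T15 holds (`SignFlip.su2_isMassiveState_dlr_of_abs_le`,
`SignFlip.su2_hasExponentialDecay_plaquetteCorrFn_dlr_of_abs_le`). -/
theorem T15_SU2MassiveTwoSided_holds : T15_SU2MassiveTwoSided :=
  fun _ h μ hμ => ⟨SignFlip.su2_isMassiveState_dlr_of_abs_le h μ hμ,
    SignFlip.su2_hasExponentialDecay_plaquetteCorrFn_dlr_of_abs_le h μ hμ⟩

/-- **The venture statement, DRAFT v1.2**: `YMGapStatementV1_1 ∧ T11 ∧ T12 ∧ T13 ∧ T14 ∧ T15`. -/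
def YMGapStatementV1_2 : Prop :=
  YMGapStatementV1_1 ∧ T11_SUNImprovedThreshold ∧ T12_SUNUniqueness ∧ T13_SUNFront ∧ T14_SUNMassive ∧
    T15_SU2MassiveTwoSided

/-- The v1.2 draft statement is PROVED (T11–T15 unconditional; inside `YMGapStatementV1_1`, T6 keeps its
three printed facts and T8 its table identities, T2 its printed criterion — all displayed, none hidden). -/
theorem yMGapStatementV1_2_holds : YMGapStatementV1_2 :=
  ⟨yMGapStatementV1_1_holds, T11_SUNImprovedThreshold_holds, T12_SUNUniqueness_holds, T13_SUNFront_holds,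
    T14_SUNMassive_holds, T15_SU2MassiveTwoSided_holds⟩

/-! ## DRAFT v1.3 + v1.4 append (2026-08-23, seat p3-g3): index only — bodies and honest framing of T17, T19,
T20 in `StatementConjunctsV13.lean`, of T16, T18, T21 in `StatementConjunctsV14.lean` (both under
`Summits/Ventures/YMGap/`); `YMGapStatementV1_2` keeps its meaning. -/

/-- **The venture statement, DRAFT v1.3**: `YMGapStatementV1_2 ∧ T17 ∧ T19 ∧ T20` (T17 Tomboulis's RP
propositions on every even torus, unconditional; T19/T20 the `SU(3)` certified rows with their one-link
hypotheses displayed inside; T16, T18 reserved). -/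
def YMGapStatementV1_3 : Prop :=
  YMGapStatementV1_2 ∧ T17_TomboulisRPEvenTorus ∧ T19_SU3CertifiedRows ∧ T20_SU3AreaLawNineTenths

/-- The v1.3 draft statement is PROVED. -/
theorem yMGapStatementV1_3_holds : YMGapStatementV1_3 :=
  ⟨yMGapStatementV1_2_holds, T17_TomboulisRPEvenTorus_holds, T19_SU3CertifiedRows_holds,
    T20_SU3AreaLawNineTenths_holds⟩

/-- **The venture statement, DRAFT v1.4**: `YMGapStatementV1_3 ∧ T16 ∧ T18 ∧ T21` (T16 the hypothesis-free
`ImprovedThreshold d N (1/(8d))` for all `d ≥ 3`, `N ≥ 2`; T18 the star rows in every dimension; T21 Tomboulis's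
IV.2 (ii) on every even torus — all unconditional). -/
def YMGapStatementV1_4 : Prop :=
  YMGapStatementV1_3 ∧ T16_SUNSharpBakryEmeryThreshold ∧ T18_SUNStarRowsAllDimensions ∧ T21_TomboulisZplusLowerBound

/-- The v1.4 draft statement is PROVED. -/
theorem yMGapStatementV1_4_holds : YMGapStatementV1_4 :=
  ⟨yMGapStatementV1_3_holds, T16_SUNSharpBakryEmeryThreshold_holds, T18_SUNStarRowsAllDimensions_holds,
    T21_TomboulisZplusLowerBound_holds⟩

/-- **The venture statement, DRAFT v1.5** (2026-08-23, seat p3-g4, PLAN R200; bodies in `StatementConjunctsV15.lean`):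
`YMGapStatementV1_4 ∧ T22 ∧ … ∧ T28` — track Y2's rows on the typed perturbation balls (T22 `SU(2)` tier-1 `ℤ⁴`
ball, T23 the massive-state conversion, T24 all-`N` and `SU(3)` rows, T25 torus balls, T26 area law on the ball,
T27 tier-2 `ℤ⁴` ball — all unconditional; T28: the tier-2 window-free area law is REFUTED). T29 reserved. -/
def YMGapStatementV1_5 : Prop :=
  YMGapStatementV1_4 ∧ T22_SU2BallMassGap ∧ T23_BallMassiveConversion ∧ T24_SUNBallRows ∧
    T25_SU2TorusBallClustering ∧ T26_SU2BallAreaLaw ∧ T27_SU2TierTwoBallMassGap ∧ T28_TierTwoAreaLawNoGo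

/-- The v1.5 draft statement is PROVED (T22–T28 hypothesis-free; earlier conditional conjuncts keep their
displayed hypotheses inside `YMGapStatementV1_4`). -/
theorem yMGapStatementV1_5_holds : YMGapStatementV1_5 :=
  ⟨yMGapStatementV1_4_holds, T22_SU2BallMassGap_holds, T23_BallMassiveConversion_holds, T24_SUNBallRows_holds,
    T25_SU2TorusBallClustering_holds, T26_SU2BallAreaLaw_holds, T27_SU2TierTwoBallMassGap_holds,
    T28_TierTwoAreaLawNoGo_holds⟩

/-- **The venture statement, DRAFT v1.6** (PLAN R201; bodies in `StatementConjunctsV16.lean`): `YMGapStatementV1_5 ∧ T30 ∧ T31`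
(T30 Tomboulis's decimation propositions on finite tori; T31 the area law on the ball, every `N`; unconditional). -/
def YMGapStatementV1_6 : Prop :=
  YMGapStatementV1_5 ∧ T30_TomboulisDecimationBounds ∧ T31_BallAreaLawVertex

/-- The v1.6 draft statement is PROVED. -/
theorem yMGapStatementV1_6_holds : YMGapStatementV1_6 :=
  ⟨yMGapStatementV1_5_holds, T30_TomboulisDecimationBounds_holds, T31_BallAreaLawVertex_holds⟩

end Summit.Ventures.YMGap
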